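import Summits.RiemannHypothesis.RiemannHypothesis.Theorems.TiltedLandingLaw421R3Lens1ArcSignR

/-!
# W-08 · 33346 · lens-1 part T (v2, SUPPORT ONLY) — CERTIFICATE KIT: capture-safe clearance (point certificate v2) and the Newton–Rouché child certificate

(lens-1 g8; ONE project import = part R `…R3Lens1ArcSignR`; namespace `RhW08.Lens1ArcSign`; 0 `sorry`; checked BY CHAIN over the tree part M with N, P, Q, R
inlined.)  Two row-level INSTRUMENTS that turn a float census of `TopPinning`ʼs first disjunct (a non-real child of the top `a` in aʼs CLOSED Jensen disc) into
theorem-grade certificates, and the bank numbers that go with them.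

§1 CAPTURE-SAFE CLEARANCE.  Part Rʼs point certificate needs, at the certifying point `z`, that every non-real level-`j` zero `r ≠ a, ā` be NESTED in aʼs disc
or INVISIBLE from `z` (`2·Im r² < (Re z − Re r)² + 2·Im z²`).  That is too crude next to a TWIN of `a` (a zero beside `a`, slightly lower: neither nested nor
invisible).  ★ `nestedStep_of_safe`: if `z ∈ D̄ᴶ_w`, `w ∈ D̄_r` and, with `A := Im a² − Im r² − (Re r − Re a)(Re z − Re a)`, `0 ≤ A` and
`(Re r − Re a)²·(2(Im r² − Im z²) − (Re r − Re z)²) ≤ A²`, then `w ∈ D̄_a` (pure real algebra: the two disc inequalities confine `2·Re w − Re r − Re z =: t` to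
`t² ≤ 2(Im r² − Im z²) − (Re r − Re z)²` and bound `|w − Re a|²` by a function LINEAR in `t`).  `CertClear2` = Rʼs `CertClear` with this fifth clause;
`certClear2_of_certClear`; ★★ `exists_nestedChild_of_pointCert2`; row-level `pinning_of_pointCert2`.  NO ∀-law is defined (v1ʼs `PointCertLaw2Q` and its two glue
theorems are WITHDRAWN per (CA748): C6ʼs W9 — a LEGAL class-E frame, K ≥ 0, whose top has NO non-real child in its closed Jensen disc, `TopPinning` holding by the
NL branch — makes every disjunct-1-only ∀-law (`PointCertLawQ`, `PointCertLaw2Q`, `RoucheCertLawQ`) false as typed; the certificates and producers below are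
row-level and unconditional, hence unaffected).

§2 THE NEWTON–ROUCHÉ CHILD CERTIFICATE (a posteriori, universal for simple children).  ★ `exists_zero_near_of_linear_rouche`: `H` differentiable, `d ≠ 0`,
`0 < r`, and `‖H z − d·(z − w)‖ < ‖d‖·r` on the circle `‖z − w‖ = r` ⇒ `H` has a zero in the open ball (tree Rouché `existsUnique_zero_of_norm_sub_lt` against the
linear comparison `d·(z − w)`).  `NewtonCert f j a w d r` adds the landing geometry (`‖w − Re a‖ + r ≤ Im a`, `r < Im w`); ★★ `exists_child_of_newtonCert` ⇒ a
non-real child `u` of `a` with `NestedStep a u`, `‖u − w‖ < r`; row-level `pinning_of_newtonCert`.  The instrument takes `w` = the numerically located child,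
`d = f^{(j+2)}(w)`, `r` small: ONE inequality on ONE circle, no structure needed — it certifies EVERY row whose child is simple and strictly inside.

BANK NUMBERS (`linktoy/bankcert.py` on C6ʼs 1 163-row bank `crit-g4/q12bank/q12bank_1163.json`, each row the literal function `G = e^{gz}·∏(z − p)`, which
IS real entire of order `1 < 2`, so the theorems apply to the row itself with no dictionary): part R point certificate at the rowʼs tilt 1 154/1 163 (40-grid;
tilt-free margin version 140/1 163); ★ capture-safe point certificate (§1) 1 163/1 163 (40-grid 1 161, the two twin rows with a 200-grid; the safe clause proper
is used on 93 zero-instances; every certificate VERIFIED: the certifying `z` is captured by a located child and every capturing child lies in `D̄_a` — 0 violations);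
part S Rouché certificate 946/1 163 (rising with `‖c‖·Im a`: [4,8) 36/125 · [8,12) 332/406 · [12,16) 214/238 · ≥ 16 364/394); Newton–Rouché (§2, radius
`≤ 10⁻²·Im a` at the located child) 1 162/1 163 (the miss is the float child LOCATOR diverging on one row, not the certificate).  So the bankʼs «law holds
1 163/1 163» is now 1 163 finite certificates, each ONE explicit inequality check away from a THEOREM instance of disjunct 1 — not a float root count.

NOT claimed: any ∀-law (`PointCertLawQ`, `RoucheCertLawQ` are settled NEGATIVES by W9; `TopLinkLawQ`, `TopPinning` OPEN).  Nothing here bears on the truth of RH; RH is not proved.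
-/

noncomputable section

namespace RhW08.Lens1ArcSign

open Complex Set Metric Filter Topology
open scoped Real ComplexConjugate
open Literature.Topology.PlaneTopology Literature.Analysis.Complex
open Summit.RiemannHypothesis.RiemannHypothesis.Theorems.Splittings.JensenWindow
open RhIdea6.G17.W07C7 RhIdea6.G17.W07C7.Rev6 RhIdea6.G18.W07C8.Law421BirthS RhIdea6.G19.W07C11.Seam
open RhIdea6.G20.W07C12.Frac RhIdea6.G20.W07C12.StColP RhW07.C12.FieldSplit RhIdea6.G21.W07C13.TentMax
open RhW07.C14.TwoSided RhW07.C14.Classes RhW07.C14.Lineage RhW07.C14.Booking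
open RhW07.C13.Heredity RhIdea6.G22.W07C15pre.Injection RhW07.E3.Cell RhW07.E3.Lit
open RhW08.Round1 RhW08.StSwap RhW08.Round2 RhW08.QuadW RhW08.SealSwapQ RhW08.SealSwap RhW08.SuccB RhW08.SuccSplit
open RhW08.SuccTheft RhW08.Column RhW08.Hurwitz RhW08.ClusterQ RhW08.ClusterQM RhW08.NewtonDoor RhW08.NewtonDoorGenusOne RhW08.PurseP
open RhW08.Lens1SignCut RhW08.Lens1Coverage RhW08.IsolatedTilt RhW08.Lens1Pinning RhW08.Lens1PinningIso



/-! ## §1 capture-safe clearance: the point certificate next to a twin -/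

/-- ★ CAPTURE-SAFE GEOMETRY (pure real algebra): `z ∈ D̄ᴶ_w`, `w ∈ D̄_r`, and with `A := Im a² − Im r² − (Re r − Re a)(Re z − Re a)`: `0 ≤ A` and
`(Re r − Re a)²·(2(Im r² − Im z²) − (Re r − Re z)²) ≤ A²` ⇒ `w ∈ D̄_a`. -/
theorem nestedStep_of_safe {a r w z : ℂ} (hzw : ‖z - (w.re : ℂ)‖ ≤ |w.im|) (hwr : ‖w - (r.re : ℂ)‖ ≤ |r.im|)
    (hA : 0 ≤ a.im ^ 2 - r.im ^ 2 - (r.re - a.re) * (z.re - a.re))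
    (hS : (r.re - a.re) ^ 2 * (2 * (r.im ^ 2 - z.im ^ 2) - (r.re - z.re) ^ 2) ≤ (a.im ^ 2 - r.im ^ 2 - (r.re - a.re) * (z.re - a.re)) ^ 2) :
    NestedStep a w := by
  have h1 := (norm_sub_re_le_iff z w).1 hzw
  have h2 := (norm_sub_re_le_iff w r).1 hwr
  have hQ : (2 * w.re - r.re - z.re) ^ 2 ≤ 2 * (r.im ^ 2 - z.im ^ 2) - (r.re - z.re) ^ 2 := by nlinarith [h1, h2]
  have hsq : ((r.re - a.re) * (2 * w.re - r.re - z.re)) ^ 2 ≤ (a.im ^ 2 - r.im ^ 2 - (r.re - a.re) * (z.re - a.re)) ^ 2 := by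
    calc ((r.re - a.re) * (2 * w.re - r.re - z.re)) ^ 2 = (r.re - a.re) ^ 2 * (2 * w.re - r.re - z.re) ^ 2 := by ring
      _ ≤ (r.re - a.re) ^ 2 * (2 * (r.im ^ 2 - z.im ^ 2) - (r.re - z.re) ^ 2) := mul_le_mul_of_nonneg_left hQ (sq_nonneg _)
      _ ≤ (a.im ^ 2 - r.im ^ 2 - (r.re - a.re) * (z.re - a.re)) ^ 2 := hS
  have hle : (r.re - a.re) * (2 * w.re - r.re - z.re) ≤ a.im ^ 2 - r.im ^ 2 - (r.re - a.re) * (z.re - a.re) := (abs_le_of_sq_le_sq' hsq hA).2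
  show (w.re - a.re) ^ 2 + w.im ^ 2 ≤ a.im ^ 2
  nlinarith [h2, hle]

/-- CERT-CLEAR v2: part Rʼs `CertClear` with the capture-safe clause added (every non-real level-`j` zero `r` is `a`, `ā`, nested, invisible from `z`, or safe). -/
def CertClear2 (f : ℂ → ℂ) (j : ℕ) (a z : ℂ) : Prop :=
  ∀ r : ℂ, iteratedDeriv j f r = 0 → r.im ≠ 0 →
    r = a ∨ r = conj a ∨ |r.re - a.re| + |r.im| ≤ a.im ∨ 2 * r.im ^ 2 < (z.re - r.re) ^ 2 + 2 * z.im ^ 2 ∨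
      (0 ≤ a.im ^ 2 - r.im ^ 2 - (r.re - a.re) * (z.re - a.re) ∧
        (r.re - a.re) ^ 2 * (2 * (r.im ^ 2 - z.im ^ 2) - (r.re - z.re) ^ 2) ≤ (a.im ^ 2 - r.im ^ 2 - (r.re - a.re) * (z.re - a.re)) ^ 2)

/-- `CertClear ⟹ CertClear2` (v2 only adds a clause). -/
theorem certClear2_of_certClear {f : ℂ → ℂ} {j : ℕ} {a z : ℂ} (h : CertClear f j a z) : CertClear2 f j a z := by
  intro r hr hri
  rcases h r hr hri with h | h | h | h
  · exact Or.inl h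
  · exact Or.inr (Or.inl h)
  · exact Or.inr (Or.inr (Or.inl h))
  · exact Or.inr (Or.inr (Or.inr (Or.inl h)))

/-- At a cert-clear-v2 point, whichever zero captures the child, the child is in aʼs closed disc. -/
theorem nestedStep_of_certClear2 {f : ℂ → ℂ} {j : ℕ} {a z w r : ℂ} (hc : CertClear2 f j a z) (hzw : ‖z - (w.re : ℂ)‖ ≤ |w.im|)
    (hr : iteratedDeriv j f r = 0) (hri : r.im ≠ 0) (hwr : ‖w - (r.re : ℂ)‖ ≤ |r.im|) : NestedStep a w := by
  rcases hc r hr hri with h | h | h | h | h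
  · subst h; exact (norm_sub_re_le_iff w r).1 hwr
  · subst h
    have h' := (norm_sub_re_le_iff w (conj a)).1 hwr
    rw [Complex.conj_re, Complex.conj_im, neg_sq] at h'
    exact h'
  · exact nestedStep_of_mem_nestedDisc h hwr
  · exact (not_capture_of_invisible h hzw hwr).elim
  · exact nestedStep_of_safe hzw hwr h.1 h.2

/-- ★★ POINT CERTIFICATE v2 ⇒ NESTED CHILD (as part Rʼs `exists_nestedChild_of_pointCert`, with capture-safe clearance). -/
theorem exists_nestedChild_of_pointCert2 {f : ℂ → ℂ} (hf : RealEntireLt2 f) (j : ℕ) {a z : ℂ} (ha : iteratedDeriv j f a = 0) (hz : 0 < z.im)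
    (hex : ∃ r, iteratedDeriv (j + 1) f r = 0) (hpos : 0 ≤ (iteratedDeriv (j + 2) f z / iteratedDeriv (j + 1) f z).im)
    (hc : CertClear2 f j a z) : ∃ w : ℂ, iteratedDeriv (j + 1) f w = 0 ∧ w.im ≠ 0 ∧ NestedStep a w := by
  obtain ⟨w₀, hw₀, hw₀i, hzw₀⟩ := exists_childDisc_of_im_nonneg hf j hz hex hpos
  have hG1 : RealEntireLt2 (iteratedDeriv (j + 1) f) := RhW08.WindowLoss.realEntireLt2_iteratedDeriv hf (j + 1)
  obtain ⟨w, hw, hwpos, hzw⟩ : ∃ w : ℂ, iteratedDeriv (j + 1) f w = 0 ∧ 0 < w.im ∧ ‖z - (w.re : ℂ)‖ ≤ |w.im| := by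
    rcases lt_or_gt_of_ne hw₀i with hneg | hposw
    · refine ⟨conj w₀, ?_, ?_, ?_⟩
      · rw [apply_conj_eq_conj hG1.diff hG1.real, hw₀, map_zero]
      · rw [Complex.conj_im]; linarith
      · rw [Complex.conj_re, Complex.conj_im, abs_neg]; exact hzw₀
    · exact ⟨w₀, hw₀, hposw, hzw₀⟩
  obtain ⟨r, hr, hri, hwr⟩ := child_mem_jensenDisc hf j hw hwpos ⟨a, ha⟩
  exact ⟨w, hw, hwpos.ne', nestedStep_of_certClear2 hc hzw hr hri hwr⟩

/-- Row-level producer v2 (what the instrument certifies for ONE frame). -/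
theorem pinning_of_pointCert2 {η : ℝ} {f : ℂ → ℂ} {x₀ s hmax R Hs : ℝ} {B : ℕ} (hE : EngineHyps5 2 η f x₀ s hmax R Hs B) {j : ℕ} {a z : ℂ}
    (ha : iteratedDeriv j f a = 0) (hz : 0 < z.im) (hex : ∃ r, iteratedDeriv (j + 1) f r = 0)
    (hpos : 0 ≤ (iteratedDeriv (j + 2) f z / iteratedDeriv (j + 1) f z).im) (hc : CertClear2 f j a z) :
    (∃ w : ℂ, iteratedDeriv (j + 1) f w = 0 ∧ w.im ≠ 0 ∧ NestedStep a w) ∨ (∃ x : ℝ, |x - a.re| ≤ a.im ∧ NLEventOf f j x) :=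
  Or.inl (exists_nestedChild_of_pointCert2 (realEntireLt2_of_hyps hE) j ha hz hex hpos hc)

/-! ## §2 the Newton–Rouché child certificate (a posteriori, universal for simple children) -/

/-- ★ LINEAR ROUCHÉ: `H` differentiable, `d ≠ 0`, `0 < r`, `‖H z − d·(z − w)‖ < ‖d‖·r` on `‖z − w‖ = r` ⇒ `H` has a zero in the open ball `B(w, r)`. -/
theorem exists_zero_near_of_linear_rouche {H : ℂ → ℂ} (hH : Differentiable ℂ H) {w d : ℂ} (hd : d ≠ 0) {r : ℝ} (hr : 0 < r)
    (h : ∀ z : ℂ, ‖z - w‖ = r → ‖H z - d * (z - w)‖ < ‖d‖ * r) : ∃ u : ℂ, ‖u - w‖ < r ∧ H u = 0 := by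
  set g : ℂ → ℂ := fun z => d * (z - w) with hg
  have hfd : DifferentiableOn ℂ H (ball w (2 * r)) := hH.differentiableOn
  have hgd : DifferentiableOn ℂ g (ball w (2 * r)) := ((differentiable_id.sub_const w).const_mul d).differentiableOn
  have hR : ∀ z : ℂ, ‖z - w‖ = r → ‖H z - g z‖ < ‖g z‖ := by
    intro z hz
    have hgz : g z = d * (z - w) := rfl
    rw [hgz, norm_mul, hz]
    exact h z hz
  have hg0 : g w = 0 := by show d * (w - w) = 0; rw [sub_self, mul_zero]
  have hg1 : deriv g w ≠ 0 := by
    have hd' : HasDerivAt g (d * 1) w := ((hasDerivAt_id w).sub_const w).const_mul d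
    rw [hd'.deriv, mul_one]; exact hd
  have huniq : ∀ v ∈ closedBall w r, g v = 0 → v = w := by
    intro v _ hv
    rcases mul_eq_zero.1 hv with h' | h'
    · exact (hd h').elim
    · exact sub_eq_zero.1 h'
  obtain ⟨u, hu, hu0, -, -⟩ := Literature.Analysis.Complex.Rouche.existsUnique_zero_of_norm_sub_lt hr (by linarith) hfd hgd hR
    (mem_closedBall_self hr.le) hg0 hg1 huniq
  exact ⟨u, hu, hu0⟩

/-- The NEWTON–ROUCHÉ CERTIFICATE of a child of `a` (row-level, explicit): centre `w` (the numerically located child), slope `d ≠ 0`, radius `r > 0`;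
the ball lands in aʼs closed disc above the axis; and `‖f^{(j+1)}(z) − d·(z − w)‖ < ‖d‖·r` on the circle `‖z − w‖ = r`. -/
def NewtonCert (f : ℂ → ℂ) (j : ℕ) (a w d : ℂ) (r : ℝ) : Prop :=
  0 < r ∧ d ≠ 0 ∧ ‖w - (a.re : ℂ)‖ + r ≤ a.im ∧ r < w.im ∧
    ∀ z : ℂ, ‖z - w‖ = r → ‖iteratedDeriv (j + 1) f z - d * (z - w)‖ < ‖d‖ * r

/-- ★★ NEWTON–ROUCHÉ CERTIFICATE ⇒ NESTED CHILD: a zero `u` of `f^{(j+1)}` with `‖u − w‖ < r`, `Im u > 0` (so non-real) and `NestedStep a u`. -/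
theorem exists_child_of_newtonCert {f : ℂ → ℂ} {j : ℕ} (hf : Differentiable ℂ (iteratedDeriv (j + 1) f)) {a w d : ℂ} {r : ℝ}
    (hN : NewtonCert f j a w d r) : ∃ u : ℂ, iteratedDeriv (j + 1) f u = 0 ∧ u.im ≠ 0 ∧ NestedStep a u ∧ ‖u - w‖ < r := by
  obtain ⟨hr, hd, hball, hup, hsmall⟩ := hN
  obtain ⟨u, hu, hu0⟩ := exists_zero_near_of_linear_rouche hf hd hr hsmall
  have h2 : ‖u - (a.re : ℂ)‖ ≤ |a.im| := by
    calc ‖u - (a.re : ℂ)‖ ≤ ‖u - w‖ + ‖w - (a.re : ℂ)‖ := norm_sub_le_norm_sub_add_norm_sub _ _ _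
      _ ≤ a.im := by linarith
      _ ≤ |a.im| := le_abs_self _
  have h3 : |(u - w).im| ≤ ‖u - w‖ := Complex.abs_im_le_norm _
  rw [Complex.sub_im, abs_le] at h3
  have hupos : 0 < u.im := by linarith [h3.1]
  exact ⟨u, hu0, hupos.ne', (norm_sub_re_le_iff u a).1 h2, hu⟩

/-- Row-level producer: a Newton–Rouché certificate at a zero `a` of `f^{(j)}` on a legal frame gives `TopPinning`ʼs first disjunct for `a`. -/
theorem pinning_of_newtonCert {η : ℝ} {f : ℂ → ℂ} {x₀ s hmax R Hs : ℝ} {B : ℕ} (hE : EngineHyps5 2 η f x₀ s hmax R Hs B) {j : ℕ} {a w d : ℂ} {r : ℝ}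
    (hN : NewtonCert f j a w d r) :
    (∃ u : ℂ, iteratedDeriv (j + 1) f u = 0 ∧ u.im ≠ 0 ∧ NestedStep a u) ∨ (∃ x : ℝ, |x - a.re| ≤ a.im ∧ NLEventOf f j x) := by
  obtain ⟨u, hu, hui, hn, -⟩ :=
    exists_child_of_newtonCert (RhW08.WindowLoss.realEntireLt2_iteratedDeriv (realEntireLt2_of_hyps hE) (j + 1)).diff hN
  exact Or.inl ⟨u, hu, hui, hn⟩

end RhW08.Lens1ArcSign
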